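import Summits.CriticalPhenomena.PercolationContinuityZ3.Theorems.PercNearOneGluingNoHeavyLowerTailSunflowerMultiPetalKempeMarkedContract
import Summits.CriticalPhenomena.PercolationContinuityZ3.Theorems.PercNearOneGluingNoHeavyLowerTailSunflowerMultiPetalKempeMarkedQSide
import HarnessLib
import HarnessLib.Audit

/-!
# `NoHeavyLowerTail` (crux stmt-CriticalPhenomena-4575), marked-multigraph layer: COLOUR PERMUTATIONS, FREE VERTICES, and the TYPE OF A
# MONOCHROMATIC CONTRACTION (infrastructure for THEOREM R and the Lemma-B induction)

Support file (seat `prim-l12-p2` gen 49; `--supports stmt-CriticalPhenomena-4575`; continuation of `…KempeMarkedContract` (p596768: `addAtU`, `contractOne`,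
`peelContract_insert`) and `…KempeMarkedQSide` (p597318)).  No `sorry`; nothing is asserted about the crux.
Memo: run/shared/lean/prim/prim-l12/prim-l12-p2/FINDING-g47-NEIGHBOURHOOD-CONTRACTION-STEP.md §6 (b)–(d); PROOF-LEMMA-B-MARKED-MULTIGRAPHS-g47.md §1, §3.

* COLOUR PERMUTATIONS: `permCT`, `cntM_comp_perm`, `ctypeM_comp_perm` (recolouring by `π` permutes the type by `ψ = π⁻¹`), `lbW_permCT` (the Lemma-B weight is
  symmetric), `fC_permCT` (`fC ∘ permCT ψ = fC2 (ψ 0) (ψ 1)`: the two-terminal weight for an arbitrary ordered colour pair), `exists_colourPerm`;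
* FREE VERTICES (`IsFree`: isolated and unmarked): the type ignores their colour (`ctypeM_update_of_isFree`), the general THREE-TO-ONE lemma
  `sum_filter_eq_three_mul` (pin the colour of one free vertex inside any filter that ignores it) and its iteration `sum_filter_eq_pow_mul` over a finite set;
* MONOCHROMATIC CONTRACTION: `cntM_contractOne` (any colour of `u`), **`ctypeM_peelContract_of_const`** — if `ρ` is constant on `S ∪ {u}` then
  `type_{K.peelContract x S u} ρ = type_{K.isolate x} ρ` (contracting a monochromatic set changes no member's status); `addMark`, `ctypeM_addMark`;
  freeness of `x` and `S` in `K.peelContract x S u`.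
-/

namespace Summit.CriticalPhenomena.PercolationContinuityZ3.Theorems.SunflowerPartition.Kempe

open Finset

/-! ## Colour permutations on types (finite checks) -/

/-- The type read through a colour map `ψ`: coordinate `c` of `permCT ψ t` is coordinate `ψ c` of `t`. [this work] -/
def permCT (ψ : Fin 3 → Fin 3) (t : CType) : CType := (coord t (ψ 0), coord t (ψ 1), coord t (ψ 2))

/-- The Lemma-B weight is invariant under coordinate permutations. (finite check) [this work] -/
theorem lbW_permCT : ∀ ψ : Fin 3 → Fin 3, (∀ a b, ψ a = ψ b → a = b) → ∀ t : CType, lbW (permCT ψ t) = lbW t := by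
  decide +kernel

/-- The two-terminal weight read through `ψ` is the two-terminal weight for the colour pair `(ψ 0, ψ 1)`. (finite check) [this work] -/
theorem fC_permCT : ∀ ψ : Fin 3 → Fin 3, (∀ a b, ψ a = ψ b → a = b) → ∀ t : CType, fC (permCT ψ t) = fC2 (ψ 0) (ψ 1) t := by
  decide +kernel

/-- For every ordered pair of distinct colours there is a colour permutation `ψ` (with inverse `π`) taking `0 ↦ a`, `1 ↦ b`. (finite check) [this work] -/
theorem exists_colourPerm : ∀ a b : Fin 3, a ≠ b →
    ∃ ψ π : Fin 3 → Fin 3, ψ 0 = a ∧ ψ 1 = b ∧ (∀ c, π (ψ c) = c) ∧ (∀ c, ψ (π c) = c) := by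
  decide +kernel

/-- Two saturated boundary colours make the one-point kernel nonnegative (coordinate form). (finite check) [this work] -/
theorem kerAbs_nonneg_of_coord_two_two : ∀ (a b : Fin 3) (t d : CType), a ≠ b → coord d a = 2 → coord d b = 2 → 0 ≤ kerAbs t d := by
  decide

/-- In `Fin 3`, two elements avoiding the same two distinct elements coincide. (finite check) [this work] -/
theorem fin3_third_unique : ∀ a b c c' : Fin 3, a ≠ b → c ≠ a → c ≠ b → c' ≠ a → c' ≠ b → c = c' := by decide

namespace MGraph

variable {V : Type*} [Fintype V] [LinearOrder V] (K : MGraph V)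

/-! ## Recolouring by a colour permutation -/

section Perm

/-- Coordinates of the type are the capped member counts. [this work] -/
theorem coord_ctypeM (σ : V → Fin 3) (c : Fin 3) : coord (K.ctypeM σ) c = cap3 (K.cntM σ c) := by
  unfold coord ctypeM
  fin_cases c <;> simp

/-- Member counts after recolouring by `π` (inverse `ψ`): colour `c` counts what colour `ψ c` counted. [this work] -/
theorem cntM_comp_perm (π ψ : Fin 3 → Fin 3) (hπψ : ∀ c, π (ψ c) = c) (hψπ : ∀ c, ψ (π c) = c) (σ : V → Fin 3) (c : Fin 3) :
    K.cntM (fun w => π (σ w)) c = K.cntM σ (ψ c) := by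
  unfold cntM
  have h : ∀ w, (π (σ w) = c) ↔ (σ w = ψ c) := fun w => ⟨fun e => by rw [← e, hψπ], fun e => by rw [e, hπψ]⟩
  simp only [h]

/-- The type after recolouring by `π` is the type read through `ψ = π⁻¹`. [this work] -/
theorem ctypeM_comp_perm (π ψ : Fin 3 → Fin 3) (hπψ : ∀ c, π (ψ c) = c) (hψπ : ∀ c, ψ (π c) = c) (σ : V → Fin 3) :
    K.ctypeM (fun w => π (σ w)) = permCT ψ (K.ctypeM σ) := by
  unfold permCT
  rw [coord_ctypeM, coord_ctypeM, coord_ctypeM]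
  unfold ctypeM
  rw [K.cntM_comp_perm π ψ hπψ hψπ σ 0, K.cntM_comp_perm π ψ hπψ hψπ σ 1, K.cntM_comp_perm π ψ hπψ hψπ σ 2]

end Perm

/-! ## Free vertices and the three-to-one lemma -/

section Free

/-- A FREE vertex: isolated and unmarked (its colour is invisible to every member count). [this work] -/
structure IsFree (y : V) : Prop where
  /-- no edges at `y` -/
  mul_eq : ∀ w, K.mul y w = 0
  /-- no marks at `y` -/
  mark_eq : K.mark y = 0

omit [Fintype V] in
/-- A free vertex is already isolated: `K.isolate y = K`. [this work] -/
theorem isolate_eq_of_isFree {y : V} (hy : K.IsFree y) : K.isolate y = K := by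
  refine ext' (fun a b => ?_) (fun a => ?_)
  · unfold isolate
    simp only
    by_cases h : a = y ∨ b = y
    · rw [if_pos h]
      rcases h with h | h
      · rw [h, hy.1 b]
      · rw [h, K.symm a y, hy.1 a]
    · rw [if_neg h]
  · unfold isolate
    simp only
    by_cases h : a = y
    · rw [if_pos h, h, hy.2]
    · rw [if_neg h]

/-- Member counts ignore the colour of a free vertex. [this work] -/
theorem cntM_update_of_isFree {y : V} (hy : K.IsFree y) (σ : V → Fin 3) (c d : Fin 3) :
    K.cntM (Function.update σ y c) d = K.cntM σ d := by
  have h := cntM_isolate_update K y σ c d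
  rw [K.isolate_eq_of_isFree hy] at h
  exact h

/-- The type ignores the colour of a free vertex. [this work] -/
theorem ctypeM_update_of_isFree {y : V} (hy : K.IsFree y) (σ : V → Fin 3) (c : Fin 3) :
    K.ctypeM (Function.update σ y c) = K.ctypeM σ := by
  unfold ctypeM
  rw [K.cntM_update_of_isFree hy σ c 0, K.cntM_update_of_isFree hy σ c 1, K.cntM_update_of_isFree hy σ c 2]

/-- **THREE-TO-ONE (general form)**: if the filter `P`, the summand `G` and the pin `e` all ignore the colour of `y`, then summing `G` over `P` is three times
summing it over the colourings in `P` whose colour at `y` is the pinned value `e`. [this work] -/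
theorem sum_filter_eq_three_mul (y : V) (P : (V → Fin 3) → Prop) [DecidablePred P] (hP : ∀ σ c, P (Function.update σ y c) ↔ P σ)
    (G : (V → Fin 3) → ℤ) (hG : ∀ σ c, G (Function.update σ y c) = G σ)
    (e : (V → Fin 3) → Fin 3) (he : ∀ σ c, e (Function.update σ y c) = e σ) :
    ∑ σ ∈ univ.filter P, G σ = 3 * ∑ σ ∈ univ.filter (fun σ => P σ ∧ σ y = e σ), G σ := by
  have hsplit : ∑ σ ∈ univ.filter P, G σ = ∑ c : Fin 3, ∑ σ ∈ univ.filter (fun σ => P σ ∧ σ y = c), G σ := by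
    rw [← sum_fiberwise (univ.filter P) (fun σ => σ y) G]
    refine sum_congr rfl fun c _ => sum_congr ?_ fun _ _ => rfl
    ext σ
    simp only [mem_filter, mem_univ, true_and]
  have hc : ∀ c : Fin 3, ∑ σ ∈ univ.filter (fun σ => P σ ∧ σ y = c), G σ = ∑ σ ∈ univ.filter (fun σ => P σ ∧ σ y = e σ), G σ := by
    intro c
    refine sum_nbij' (fun σ => Function.update σ y (e σ)) (fun σ => Function.update σ y c) ?_ ?_ ?_ ?_ ?_
    · intro σ hσ
      simp only [mem_filter, mem_univ, true_and] at hσ ⊢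
      exact ⟨(hP σ _).2 hσ.1, by rw [Function.update_self, he]⟩
    · intro σ hσ
      simp only [mem_filter, mem_univ, true_and] at hσ ⊢
      exact ⟨(hP σ _).2 hσ.1, Function.update_self ..⟩
    · intro σ hσ
      simp only [mem_filter, mem_univ, true_and] at hσ
      rw [Function.update_idem, ← hσ.2, Function.update_eq_self]
    · intro σ hσ
      simp only [mem_filter, mem_univ, true_and] at hσ
      rw [he, Function.update_idem, ← hσ.2, Function.update_eq_self]
    · intro σ _
      exact (hG σ (e σ)).symm
  rw [hsplit, sum_congr rfl (fun c _ => hc c), sum_const, card_univ, Fintype.card_fin]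
  simp

/-- **PINNING A SET OF FREE VERTICES**: for a finite set `Z` of free vertices, a filter `P` ignoring their colours and pins `e z` ignoring the colours on
`Z`, `Σ_P g(type) = 3^{|Z|} · Σ_{P ∧ ∀ z ∈ Z, σ z = e z σ} g(type)`. [this work] -/
theorem sum_filter_eq_pow_mul (g : CType → ℤ) (Z : Finset V) (hZ : ∀ z ∈ Z, K.IsFree z)
    (P : (V → Fin 3) → Prop) [DecidablePred P] (hP : ∀ z ∈ Z, ∀ σ c, P (Function.update σ z c) ↔ P σ)
    (e : V → (V → Fin 3) → Fin 3) (he : ∀ z ∈ Z, ∀ z' ∈ Z, ∀ σ c, e z (Function.update σ z' c) = e z σ) :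
    ∑ σ ∈ univ.filter P, g (K.ctypeM σ) = 3 ^ Z.card * ∑ σ ∈ univ.filter (fun σ => P σ ∧ ∀ z ∈ Z, σ z = e z σ), g (K.ctypeM σ) := by
  induction Z using Finset.induction_on with
  | empty =>
    rw [card_empty, pow_zero, one_mul]
    refine sum_congr ?_ fun _ _ => rfl
    ext σ; simp
  | @insert z Z hz ih =>
    have hZ' : ∀ z' ∈ Z, K.IsFree z' := fun z' hz' => hZ z' (mem_insert_of_mem hz')
    have hP' : ∀ z' ∈ Z, ∀ σ c, P (Function.update σ z' c) ↔ P σ := fun z' hz' => hP z' (mem_insert_of_mem hz')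
    have he' : ∀ z₁ ∈ Z, ∀ z₂ ∈ Z, ∀ σ c, e z₁ (Function.update σ z₂ c) = e z₁ σ :=
      fun z₁ h₁ z₂ h₂ => he z₁ (mem_insert_of_mem h₁) z₂ (mem_insert_of_mem h₂)
    rw [ih hZ' hP' he', card_insert_of_notMem hz, pow_succ, mul_assoc]
    congr 1
    -- pin the colour of z inside the filter `P ∧ (pins on Z)`
    have h3 := sum_filter_eq_three_mul z (fun σ => P σ ∧ ∀ z' ∈ Z, σ z' = e z' σ) (fun σ c => ?_)
      (fun σ => g (K.ctypeM σ)) (fun σ c => by simp only [K.ctypeM_update_of_isFree (hZ z (mem_insert_self z Z))])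
      (e z) (fun σ c => he z (mem_insert_self z Z) z (mem_insert_self z Z) σ c)
    · rw [h3]
      congr 1
      refine sum_congr ?_ fun _ _ => rfl
      ext σ
      simp only [mem_filter, mem_univ, true_and, forall_mem_insert]
      tauto
    · -- the filter ignores the colour of z
      refine ⟨fun h => ⟨(hP z (mem_insert_self z Z) σ c).1 h.1, fun z' hz' => ?_⟩, fun h => ⟨(hP z (mem_insert_self z Z) σ c).2 h.1, fun z' hz' => ?_⟩⟩
      · have hne : z' ≠ z := fun e => hz (e ▸ hz')
        have := h.2 z' hz'
        rwa [Function.update_of_ne hne, he z' (mem_insert_of_mem hz') z (mem_insert_self z Z)] at this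
      · have hne : z' ≠ z := fun e => hz (e ▸ hz')
        rw [Function.update_of_ne hne, he z' (mem_insert_of_mem hz') z (mem_insert_self z Z)]
        exact h.2 z' hz'

end Free

/-! ## Contracting a monochromatic set does not change the type -/

section MonoContract

/-- **Member counts of a single-vertex contraction, any colour at the target**: contracting `s` into `u` gives the counts of `K` at the colouring with
`s` recoloured like `u` (generalises `ctypeM_contractOne`, which is the case `ρ u = 0`). [this work] -/
theorem cntM_contractOne (s u : V) (hsu : s ≠ u) (ρ : V → Fin 3) (c : Fin 3) :
    (K.contractOne s u).cntM ρ c = K.cntM (Function.update ρ s (ρ u)) c := by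
  unfold contractOne
  rw [cntM_addAtU, K.cntM_eq_isolate_add s (Function.update ρ s (ρ u)) c, cntM_isolate_update, Function.update_self]
  by_cases h0 : ρ u = c
  · rw [if_pos h0, if_pos h0]
    have key : ∀ w : V, (if Function.update ρ s (ρ u) w = c then K.mul s w else 0)
        = (if ρ w = c then (if w = s ∨ w = u then 0 else K.mul s w) else 0) + (if w = u then K.mul s u else 0) := by
      intro w
      by_cases hws : w = s
      · subst hws; simp [K.loopless, hsu]
      · by_cases hwu : w = u
        · subst hwu; rw [Function.update_of_ne hws, if_pos h0]; simp [hws]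
        · rw [Function.update_of_ne hws]; simp [hws, hwu]
    unfold linkM
    rw [sum_congr rfl (fun w _ => key w), sum_add_distrib, sum_ite_eq' univ u]
    simp only [mem_univ, if_true]
    ring
  · rw [if_neg h0, if_neg h0]

/-- **CONTRACTING A MONOCHROMATIC SET CHANGES NO TYPE**: if `ρ` is constant on `S ∪ {u}` then the type of `ρ` in `K.peelContract x S u` equals its type
in `K.isolate x` (every member keeps its monochromatic status and colour when a monochromatic vertex set is identified). [this work] -/
theorem cntM_peelContract_of_const (x u : V) (S : Finset V) (hux : u ≠ x) (huS : u ∉ S) (hxS : x ∉ S) (ρ : V → Fin 3)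
    (hρ : ∀ s ∈ S, ρ s = ρ u) (c : Fin 3) : (K.peelContract x S u).cntM ρ c = (K.isolate x).cntM ρ c := by
  induction S using Finset.induction_on with
  | empty => rw [peelContract_empty]
  | @insert s S hs ih =>
    have hsu : s ≠ u := fun e => huS (e ▸ mem_insert_self s S)
    have hsx : s ≠ x := fun e => hxS (e ▸ mem_insert_self s S)
    have huS' : u ∉ S := fun h => huS (mem_insert_of_mem h)
    have hxS' : x ∉ S := fun h => hxS (mem_insert_of_mem h)
    rw [K.peelContract_insert x u S s hs hsu hsx huS' hux, cntM_contractOne _ s u hsu, ← hρ s (mem_insert_self s S),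
      Function.update_eq_self]
    exact ih huS' hxS' (fun s' hs' => hρ s' (mem_insert_of_mem hs'))

/-- Type version of `cntM_peelContract_of_const`. [this work] -/
theorem ctypeM_peelContract_of_const (x u : V) (S : Finset V) (hux : u ≠ x) (huS : u ∉ S) (hxS : x ∉ S) (ρ : V → Fin 3)
    (hρ : ∀ s ∈ S, ρ s = ρ u) : (K.peelContract x S u).ctypeM ρ = (K.isolate x).ctypeM ρ := by
  unfold ctypeM
  rw [K.cntM_peelContract_of_const x u S hux huS hxS ρ hρ 0, K.cntM_peelContract_of_const x u S hux huS hxS ρ hρ 1,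
    K.cntM_peelContract_of_const x u S hux huS hxS ρ hρ 2]

/-- Add `m` marks at the vertex `w`. [this work] -/
def addMark (w : V) (m : ℕ) : MGraph V := K.addAtU w (fun _ => 0) rfl m

/-- Member counts with `m` extra marks at `w`. [this work] -/
theorem cntM_addMark (w : V) (m : ℕ) (σ : V → Fin 3) (c : Fin 3) :
    (K.addMark w m).cntM σ c = K.cntM σ c + (if σ w = c then m else 0) := by
  unfold addMark
  rw [cntM_addAtU]
  simp

/-- The type with `m` extra marks at `w` is the capped sum with `m ∧ 2` at the colour of `w`. [this work] -/
theorem ctypeM_addMark (w : V) (m : ℕ) (σ : V → Fin 3) :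
    (K.addMark w m).ctypeM σ = ctAdd (K.ctypeM σ) (xPart (σ w) (cap3 m, cap3 m, cap3 m)) := by
  unfold ctypeM ctAdd xPart
  rw [K.cntM_addMark w m σ 0, K.cntM_addMark w m σ 1, K.cntM_addMark w m σ 2]
  simp only [cap3_add, cap3_ite]

omit [Fintype V] in
/-- `x` is free in `K.peelContract x S u`. [this work] -/
theorem isFree_peelContract_self (x u : V) (S : Finset V) : (K.peelContract x S u).IsFree x := by
  refine ⟨fun w => ?_, ?_⟩
  · unfold peelContract; simp
  · unfold peelContract; simp

omit [Fintype V] in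
/-- Every vertex of `S` is free in `K.peelContract x S u`. [this work] -/
theorem isFree_peelContract_of_mem (x u : V) (S : Finset V) {s : V} (hs : s ∈ S) : (K.peelContract x S u).IsFree s := by
  refine ⟨fun w => ?_, ?_⟩
  · unfold peelContract; simp [hs]
  · unfold peelContract; simp [hs]

omit [Fintype V] in
/-- Marks elsewhere keep a vertex free. [this work] -/
theorem isFree_addMark {z : V} (w : V) (m : ℕ) (hz : K.IsFree z) (hzw : z ≠ w) : (K.addMark w m).IsFree z := by
  refine ⟨fun w' => ?_, ?_⟩
  · unfold addMark addAtU; simp [hz.1 w']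
  · unfold addMark addAtU; simp [hz.2, hzw]

omit [Fintype V] in
/-- `y` is free in `K.isolate y`. [this work] -/
theorem isFree_isolate_self (y : V) : (K.isolate y).IsFree y := by
  refine ⟨fun w => ?_, ?_⟩
  · unfold isolate; simp
  · unfold isolate; simp

omit [Fintype V] in
/-- Freeness survives isolating another vertex. [this work] -/
theorem isFree_isolate_of_isFree {z : V} (hz : K.IsFree z) (y : V) : (K.isolate y).IsFree z := by
  refine ⟨fun w => ?_, ?_⟩
  · unfold isolate; simp [hz.1 w]
  · unfold isolate; simp [hz.2]

end MonoContract

end MGraph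

end Summit.CriticalPhenomena.PercolationContinuityZ3.Theorems.SunflowerPartition.Kempe
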